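import Summits.BirchSwinnertonDyer.BirchSwinnertonDyer.Theorems.ManinLocalTwoThreeShimuraFiveForcesEleven
import HarnessLib

/-!
# `5 ∣ [Λ₀(f) : Λ₁(f)]` forces `11 ∣ N` — part 4: transport to EVERY datum (no lattice-optimality binder) (es g43 after REF1 §R241; MEMO-es §65.6)

Route `ManinLocalTwoThree`, crux C2 `ManinOddAtFour` stmt-BirchSwinnertonDyer-22967 (helper).  The conclusions of part 3 that mention only the
newform `f` and the level `N` — `11 ∣ N` (`eleven_dvd_level_of_not_shimuraIndexPrimeTo_five`), `Λ₀(f) ⊆ Λ₁(f)`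
(`periodLattice_le_gamma1_of_frobeniusTrace_two_eq_neg_two`) and the prime-level Derickx–Orlić law
(`two_mul_mem_or_three_mul_mem_primeLevel_of_ne`) — hold for EVERY `X₀(N)`-datum of a globally minimal `W` with `N = N_W` (so at every
squarefree level), by transport to the degree-optimal datum with the same newform (`exists_optimal_modularParametrizationData_of_isNewformOf'`,
`latticeEq_of_forall_modularDegree_le`; `a₂` along the isogeny: `frobeniusTrace_eq_of_isIsogenous`).  The transport lemmas are REF1's
(§R241, HOME/ref1/e241/ProbeR241A.lean ns `REF1.R241`, kernel-checked), restated in the route namespace.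

HONEST FRAMING: unconditional tree theorems (standard axioms); no definitions, no named facts, no sorry.  C2, C3, the Derickx–Orlić question at
composite level, Manin's conjecture and BSD are NOT proved by this file.
[cite: Vatsal2005, Rem. 1.8] [cite: DerickxOrlic2025, Rmk. 4.8] [cite: LingOesterle1991, Thm. 1, Thm. 6] [cite: Carayol1986, Thm. (A)]
-/

set_option linter.dupNamespace false
set_option autoImplicit false

noncomputable section

open scoped Classical MatrixGroups ModularForm PeriodPair

open CongruenceSubgroup WeierstrassCurve Field Polynomial NumberField IsDedekindDomain IsDedekindDomain.HeightOneSpectrum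
  Literature.NumberTheory.EllipticCurves
  Literature.NumberTheory.EllipticCurves.ModularForms Summit.BirchSwinnertonDyer.Rank1Residual
  Summit.BirchSwinnertonDyer.Rank1Residual.ManinAdditive Summit.BirchSwinnertonDyer.Rank1Residual.ManinAdditive.KatoCurve
  Summit.BirchSwinnertonDyer.Rank1Residual.ManinAdditive.ShimuraCover
  Summit.BirchSwinnertonDyer.BirchSwinnertonDyer.Theorems.ManinLocalTwoThree
  Summit.BirchSwinnertonDyer.BirchSwinnertonDyer.Theorems.ManinLocalTwoThree.CuspGalois
  Summit.BirchSwinnertonDyer.BirchSwinnertonDyer.Theorems.ManinLocalTwoThree.ShimuraCoverHolds Literature.NumberTheory.Automorphic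

namespace Summit.BirchSwinnertonDyer.BirchSwinnertonDyer.Theorems.ManinLocalTwoThree.ShimuraFive

/-! ### §7. Transport: the conclusions that mention only `f` and `N` need no lattice-optimality binder

(after REF1 §R241, HOME/ref1/e241/ProbeR241A.lean ns `REF1.R241`, kernel-checked there; moved here verbatim up to names).  `11 ∣ N`,
`Λ₀(f) ⊆ Λ₁(f)` and the prime-level law depend on the newform `f` alone, so they transport from ANY datum of a globally minimal `W` with
`N = N_W` (in particular at squarefree level, `ShimuraPrimeLevelAtTwo.conductorNorm_eq_of_squarefree_level`) to the degree-optimal —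
hence lattice-optimal (`latticeEq_of_forall_modularDegree_le`) — datum with the same newform
(`exists_optimal_modularParametrizationData_of_isNewformOf'`); `a₂` is transported along the isogeny at the good prime `2`
(`frobeniusTrace_eq_of_isIsogenous`). -/

/-- `11 ∣ N` from an order-`5` element of the Shimura-cover kernel, for EVERY `X₀(N)`-datum of a globally minimal `W` with `N = N_W`
(no lattice-optimality binder). [cite: Vatsal2005, Rem. 1.8] -/
theorem eleven_dvd_level_of_not_shimuraIndexPrimeTo_five_of_conductorNorm (W : WeierstrassCurve ℚ) [W.IsElliptic]
    [W.IsGloballyMinimal] {N : ℕ} [NeZero N] (hN : W.conductorNorm ℤ = N)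
    (D : ModularParametrizationData W N) (hS : ¬ ShimuraIndexPrimeTo 5 D.f) : 11 ∣ N := by
  obtain ⟨W₀, hE₀, hM₀, D₀, hf₀, -, hmin⟩ := exists_optimal_modularParametrizationData_of_isNewformOf' N W hN D.isNewformOf
  haveI := hE₀; haveI := hM₀
  have hopt₀ : ∀ z ∈ D₀.L.lattice, ∃ w ∈ periodLattice D₀.f, z = D₀.c * w :=
    D₀.latticeEq_of_forall_modularDegree_le (by simpa [hf₀] using hmin)
  exact eleven_dvd_level_of_not_shimuraIndexPrimeTo_five W₀ D₀ hopt₀ (by rw [hf₀]; exact hS)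

/-- … in particular at every SQUAREFREE level. -/
theorem eleven_dvd_level_of_not_shimuraIndexPrimeTo_five_of_squarefree (W : WeierstrassCurve ℚ) [W.IsElliptic]
    [W.IsGloballyMinimal] {N : ℕ} [NeZero N] (hsq : Squarefree N)
    (D : ModularParametrizationData W N) (hS : ¬ ShimuraIndexPrimeTo 5 D.f) : 11 ∣ N :=
  eleven_dvd_level_of_not_shimuraIndexPrimeTo_five_of_conductorNorm W
    (ShimuraPrimeLevelAtTwo.conductorNorm_eq_of_squarefree_level D hsq) D hS

/-- `a₂ = −2 ⟹ Λ₀(f) = Λ₁(f)` at odd squarefree level prime to `11`, for EVERY datum (no lattice-optimality binder). -/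
theorem periodLattice_le_gamma1_of_frobeniusTrace_two_eq_neg_two_of_squarefree (W : WeierstrassCurve ℚ) [W.IsElliptic]
    [W.IsGloballyMinimal] {N : ℕ} [NeZero N] (hsq : Squarefree N)
    (D : ModularParametrizationData W N) (hN2 : ¬ 2 ∣ N) (hN11 : ¬ 11 ∣ N) (ha : W.frobeniusTrace 2 = -2) :
    ∀ z ∈ periodLattice D.f, z ∈ periodLatticeGamma1 D.f := by
  have hN : W.conductorNorm ℤ = N := ShimuraPrimeLevelAtTwo.conductorNorm_eq_of_squarefree_level D hsq
  obtain ⟨W₀, hE₀, hM₀, D₀, hf₀, hiso, hmin⟩ := exists_optimal_modularParametrizationData_of_isNewformOf' N W hN D.isNewformOf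
  haveI := hE₀; haveI := hM₀
  have hopt₀ : ∀ z ∈ D₀.L.lattice, ∃ w ∈ periodLattice D₀.f, z = D₀.c * w :=
    D₀.latticeEq_of_forall_modularDegree_le (by simpa [hf₀] using hmin)
  haveI : Fact (Nat.Prime 2) := ⟨Nat.prime_two⟩
  have hgood : W.HasGoodReductionAtPrime 2 :=
    ShimuraIndexAtTwo.hasGoodReductionAtPrime_two_of_not_two_dvd W D.isNewformOf hN2
  have hgood₀ : W₀.HasGoodReductionAtPrime 2 :=
    ShimuraIndexAtTwo.hasGoodReductionAtPrime_two_of_not_two_dvd W₀ D₀.isNewformOf hN2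
  have ha₀ : W₀.frobeniusTrace 2 = -2 := by rw [← frobeniusTrace_eq_of_isIsogenous hiso 2 hgood hgood₀]; exact ha
  have key := periodLattice_le_gamma1_of_frobeniusTrace_two_eq_neg_two W₀ D₀ hopt₀ hN2 hN11 ha₀
  rw [hf₀] at key
  exact key

/-- **THE DERICKX–ORLIĆ EXPONENT LAW AT EVERY PRIME LEVEL `q ∉ {11, 17}`, FOR EVERY `X₀(q)`-DATUM** of a globally minimal curve
(no lattice-optimality binder): `2Λ₀(f) ⊆ Λ₁(f)` or `3Λ₀(f) ⊆ Λ₁(f)`. [cite: DerickxOrlic2025, Rmk. 4.8] [cite: LingOesterle1991, Thm. 1, Thm. 6] -/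
theorem two_mul_mem_or_three_mul_mem_primeLevel_of_ne' (W : WeierstrassCurve ℚ) [W.IsElliptic] [W.IsGloballyMinimal]
    {q : ℕ} [NeZero q] (D : ModularParametrizationData W q) (hq : q.Prime) (h11 : q ≠ 11) (h17 : q ≠ 17) :
    (∀ z ∈ periodLattice D.f, 2 * z ∈ periodLatticeGamma1 D.f) ∨
      (∀ z ∈ periodLattice D.f, 3 * z ∈ periodLatticeGamma1 D.f) := by
  have hN : W.conductorNorm ℤ = q :=
    ShimuraPrimeLevelAtTwo.conductorNorm_eq_of_squarefree_level D hq.prime.squarefree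
  obtain ⟨W₀, hE₀, hM₀, D₀, hf₀, -, hmin⟩ := exists_optimal_modularParametrizationData_of_isNewformOf' q W hN D.isNewformOf
  haveI := hE₀; haveI := hM₀
  have hopt₀ : ∀ z ∈ D₀.L.lattice, ∃ w ∈ periodLattice D₀.f, z = D₀.c * w :=
    D₀.latticeEq_of_forall_modularDegree_le (by simpa [hf₀] using hmin)
  have key := two_mul_mem_or_three_mul_mem_primeLevel_of_ne W₀ D₀ hopt₀ hq h11 h17
  rw [hf₀] at key
  exact key

end Summit.BirchSwinnertonDyer.BirchSwinnertonDyer.Theorems.ManinLocalTwoThree.ShimuraFive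

end
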